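import Summits.QuantumFields.GaugeBoot.FluctuationWeights
import Summits.QuantumFields.GaugeBoot.OneOverNSeriesCoeff
import HarnessLib

/-!
# Fluctuations of Wilson loops, X: contraction on block states (gauge-boot, ADDENDUM 32 part J)

HONEST FRAMING (cell `pub-gaugeboot`, page 1 of every file): the venture produces certified bounds
on lattice expectations at stated coupling, gauge group, dimension and torus size; NOT a mass gap,
NOT a continuum limit, NOT a string tension; NOT Yang–Mills-summit-bearing (barriers
`FixedCouplingUltralocality`, `PerturbativeInvisibility`).  Strong-coupling `SO(N)` lattice gauge theory with free boundary
condition (S. Chatterjee, Comm. Math. Phys. **366** (2019); S. Chatterjee, J. Jafarov, arXiv:1604.04777); nothing about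
four-dimensional continuum Yang–Mills or a mass gap.

## Content

★ `block_contraction`: the HOMOGENEOUS split/deform system on block states `σ = (B₀; C₁,…,C_m)`,
`|u(σ)| u(σ) = SD_{B₀} u + Σ_j SD_{C_j} u`, has only the zero solution in the exponential class `|u(σ)| ≤ M L^{|u(σ)|}` when
`|β| ≤ (4096(d+1)(L²+4)⁴)⁻¹` — the block version of the lane's `symmetrized_unique`: a Catalan-weighted contraction on the
flattening (`block_weight_le`), iterated (`SD_abs_le` is the triangle inequality used).  Plus the bookkeeping
`len_flatten`, `length_le_sum_len`.

`[new (lane)]` given part I.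
-/

noncomputable section

open Finset Filter Topology PowerSeries
open Literature.MathematicalPhysics.QuantumFieldTheory.Chatterjee2019LargeN
open Literature.MathematicalPhysics.QuantumFieldTheory.Chatterjee2019LargeN.CoeffCatalanBoundProof

namespace Summit.QuantumFields.GaugeBoot

namespace StringDuality

variable {d : ℕ}

/-! ## The homogeneous block system has only the zero solution -/

/-- Triangle inequality for the split/deform operator with termwise bounds. [folklore] -/
theorem SD_abs_le {β : ℝ} (SD : LoopSeq d → (LoopSeq d → ℝ) → ℝ)
    (hSD : ∀ (A : LoopSeq d) (g : LoopSeq d → ℝ), SD A g =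
      ((∑ o : InvIdx A, g (A.negSplitAt o)) - ∑ o : SameIdx A, g (A.posSplitAt o))
        + β * ((∑ o : DeformIdx A, g (A.negDeformAt o)) - ∑ o : DeformIdx A, g (A.posDeformAt o)))
    (A : LoopSeq d) (g : LoopSeq d → ℝ) (w : LoopSeq d → ℝ) (c : ℝ)
    (h1 : ∀ o : InvIdx A, |g (A.negSplitAt o)| ≤ c * w (A.negSplitAt o))
    (h2 : ∀ o : SameIdx A, |g (A.posSplitAt o)| ≤ c * w (A.posSplitAt o))
    (h3 : ∀ o : DeformIdx A, |g (A.negDeformAt o)| ≤ c * w (A.negDeformAt o))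
    (h4 : ∀ o : DeformIdx A, |g (A.posDeformAt o)| ≤ c * w (A.posDeformAt o)) :
    |SD A g| ≤ c * (((∑ o : InvIdx A, w (A.negSplitAt o)) + ∑ o : SameIdx A, w (A.posSplitAt o))
      + |β| * ((∑ o : DeformIdx A, w (A.negDeformAt o)) + ∑ o : DeformIdx A, w (A.posDeformAt o))) := by
  rw [hSD]
  have e1 : |∑ o : InvIdx A, g (A.negSplitAt o)| ≤ c * ∑ o : InvIdx A, w (A.negSplitAt o) := by
    rw [Finset.mul_sum]; exact (Finset.abs_sum_le_sum_abs _ _).trans (Finset.sum_le_sum fun o _ => h1 o)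
  have e2 : |∑ o : SameIdx A, g (A.posSplitAt o)| ≤ c * ∑ o : SameIdx A, w (A.posSplitAt o) := by
    rw [Finset.mul_sum]; exact (Finset.abs_sum_le_sum_abs _ _).trans (Finset.sum_le_sum fun o _ => h2 o)
  have e3 : |∑ o : DeformIdx A, g (A.negDeformAt o)| ≤ c * ∑ o : DeformIdx A, w (A.negDeformAt o) := by
    rw [Finset.mul_sum]; exact (Finset.abs_sum_le_sum_abs _ _).trans (Finset.sum_le_sum fun o _ => h3 o)
  have e4 : |∑ o : DeformIdx A, g (A.posDeformAt o)| ≤ c * ∑ o : DeformIdx A, w (A.posDeformAt o) := by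
    rw [Finset.mul_sum]; exact (Finset.abs_sum_le_sum_abs _ _).trans (Finset.sum_le_sum fun o _ => h4 o)
  calc |((∑ o : InvIdx A, g (A.negSplitAt o)) - ∑ o : SameIdx A, g (A.posSplitAt o))
        + β * ((∑ o : DeformIdx A, g (A.negDeformAt o)) - ∑ o : DeformIdx A, g (A.posDeformAt o))|
      ≤ |(∑ o : InvIdx A, g (A.negSplitAt o)) - ∑ o : SameIdx A, g (A.posSplitAt o)|
        + |β * ((∑ o : DeformIdx A, g (A.negDeformAt o)) - ∑ o : DeformIdx A, g (A.posDeformAt o))| := abs_add_le _ _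
    _ ≤ (c * ∑ o : InvIdx A, w (A.negSplitAt o) + c * ∑ o : SameIdx A, w (A.posSplitAt o))
        + |β| * (c * ∑ o : DeformIdx A, w (A.negDeformAt o) + c * ∑ o : DeformIdx A, w (A.posDeformAt o)) := by
        refine add_le_add ((abs_sub _ _).trans (add_le_add e1 e2)) ?_
        rw [abs_mul]
        exact mul_le_mul_of_nonneg_left ((abs_sub _ _).trans (add_le_add e3 e4)) (abs_nonneg β)
    _ = _ := by ring

/-- ★ **The homogeneous split/deform system on block states has only the zero solution** in the exponential class, for
`|β| ≤ (4096(d+1)(L²+4)⁴)⁻¹`: Catalan-weighted contraction on the flattening (`block_weight_le`), iterated.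
[cite: Chatterjee2019LargeN, Theorem 9.2 (the uniqueness mechanism), Lemma 10.1 (the Catalan weight)] -/
theorem block_contraction {β Mb Lb : ℝ} (hMb : 0 ≤ Mb) (hLb : 1 ≤ Lb)
    (hβ : |β| ≤ 1 / (4096 * ((d : ℝ) + 1) * (Lb ^ 2 + 4) ^ 4))
    (SD : LoopSeq d → (LoopSeq d → ℝ) → ℝ)
    (hSD : ∀ (A : LoopSeq d) (g : LoopSeq d → ℝ), SD A g =
      ((∑ o : InvIdx A, g (A.negSplitAt o)) - ∑ o : SameIdx A, g (A.posSplitAt o))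
        + β * ((∑ o : DeformIdx A, g (A.negDeformAt o)) - ∑ o : DeformIdx A, g (A.posDeformAt o)))
    (u : LoopSeq d → List (LoopSeq d) → ℝ)
    (hbd : ∀ (B₀ : LoopSeq d) (Cs : List (LoopSeq d)), IsLoopSeq B₀ → (∀ C ∈ Cs, IsLoopSeq C) →
      |u B₀ Cs| ≤ Mb * Lb ^ (B₀ ++ Cs.flatten).len)
    (hnilblk : ∀ (B₀ : LoopSeq d) (Cs : List (LoopSeq d)), [] ∈ Cs → u B₀ Cs = 0)
    (h00 : u [] [] = 0)
    (heq : ∀ (B₀ : LoopSeq d) (Cs : List (LoopSeq d)), IsLoopSeq B₀ → (∀ C ∈ Cs, IsLoopSeq C ∧ C ≠ []) →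
      B₀ ++ Cs.flatten ≠ [] →
      ((B₀ ++ Cs.flatten).len : ℝ) * u B₀ Cs - SD B₀ (fun A => u A Cs)
        - ∑ j : Fin Cs.length, SD (Cs.get j) (fun C' => u B₀ (Cs.set j C')) = 0) :
    ∀ (B₀ : LoopSeq d) (Cs : List (LoopSeq d)), IsLoopSeq B₀ → (∀ C ∈ Cs, IsLoopSeq C) → u B₀ Cs = 0 := by
  set K : ℝ := Lb ^ 2 + 4 with hKdef
  have hK4 : 4 ≤ K := by rw [hKdef]; nlinarith
  have hK1 : 1 ≤ K := by linarith
  have hK0 : 0 < K := by linarith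
  have hLK : Lb ^ 2 ≤ K := by rw [hKdef]; linarith
  set Pd : ℝ := ((2 * (d - 1) : ℕ) : ℝ) with hPdef
  have hP0 : 0 ≤ Pd := Nat.cast_nonneg _
  have hPd : Pd ≤ 2 * ((d : ℝ) + 1) := by
    have h : (2 * (d - 1) : ℕ) ≤ 2 * (d + 1) := by omega
    rw [hPdef]; exact_mod_cast h
  set θ : ℝ := 2 / K + |β| * (2 * Pd * 256 * K ^ 4) with hθdef
  have hθ0 : 0 ≤ θ := by positivity
  have hθ1 : θ < 1 := by
    have h1 : 2 / K ≤ 1 / 2 := by rw [div_le_iff₀ hK0]; linarith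
    have h2 : |β| * (2 * Pd * 256 * K ^ 4) ≤ 1 / 4 := by
      calc |β| * (2 * Pd * 256 * K ^ 4)
          ≤ (1 / (4096 * ((d : ℝ) + 1) * K ^ 4)) * (2 * (2 * ((d : ℝ) + 1)) * 256 * K ^ 4) := by
            apply mul_le_mul hβ _ (by positivity) (by positivity)
            gcongr
        _ = 1 / 4 := by field_simp; ring
    linarith
  -- the weight of a state
  have Φpos : ∀ s : LoopSeq d, 0 ≤ K ^ s.index * catProd s := fun s => mul_nonneg (pow_nonneg hK0.le _) (catProd_nonneg _)
  -- iteration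
  have hiter : ∀ n : ℕ, ∀ (B₀ : LoopSeq d) (Cs : List (LoopSeq d)), IsLoopSeq B₀ → (∀ C ∈ Cs, IsLoopSeq C) →
      |u B₀ Cs| ≤ Mb * θ ^ n * (K ^ (B₀ ++ Cs.flatten).index * catProd (B₀ ++ Cs.flatten)) := by
    intro n
    induction n with
    | zero =>
      intro B₀ Cs hB₀ hCs
      rw [pow_zero, mul_one]
      exact (hbd B₀ Cs hB₀ hCs).trans (mul_le_mul_of_nonneg_left
        (pow_len_le_weight hLb hLK (isLoopSeq_append hB₀ (isLoopSeq_flatten hCs))) hMb)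
    | succ n ih =>
      intro B₀ Cs hB₀ hCs
      have hnn : 0 ≤ Mb * θ ^ (n + 1) * (K ^ (B₀ ++ Cs.flatten).index * catProd (B₀ ++ Cs.flatten)) :=
        mul_nonneg (by positivity) (Φpos _)
      by_cases hmem : [] ∈ Cs
      · rw [hnilblk B₀ Cs hmem, abs_zero]; exact hnn
      have hCs' : ∀ C ∈ Cs, IsLoopSeq C ∧ C ≠ [] := fun C hC => ⟨hCs C hC, fun h => hmem (h ▸ hC)⟩
      by_cases hflat : B₀ ++ Cs.flatten = []
      · have hB : B₀ = [] := (List.append_eq_nil_iff.mp hflat).1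
        have hC : Cs = [] := by
          rcases Cs with _ | ⟨C, rest⟩
          · rfl
          · exfalso
            have h2 := (List.append_eq_nil_iff.mp hflat).2
            rw [List.flatten_cons, List.append_eq_nil_iff] at h2
            exact (hCs' C (by simp)).2 h2.1
        subst hB; subst hC
        rw [h00, abs_zero]; exact hnn
      -- the genuine case: use the equation
      set s := B₀ ++ Cs.flatten with hs
      have hsg : IsLoopSeq s := isLoopSeq_append hB₀ (isLoopSeq_flatten hCs)
      have hlen : (0 : ℝ) < s.len := by
        have h1 := two_mul_size_le_len hsg
        have h2 : 1 ≤ s.size := List.length_pos_of_ne_nil hflat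
        have h3 : 1 ≤ s.len := by omega
        exact_mod_cast h3
      set c : ℝ := Mb * θ ^ n with hc
      have hc0 : 0 ≤ c := by positivity
      have e := heq B₀ Cs hB₀ hCs' hflat
      -- bound the block-0 operator and each block operator
      have b0 := SD_abs_le SD hSD B₀ (fun A => u A Cs) (fun A => K ^ (A ++ Cs.flatten).index * catProd (A ++ Cs.flatten))
        c (fun o => ih _ _ (hB₀.negSplitAt o) hCs) (fun o => ih _ _ (hB₀.posSplitAt o) hCs)
        (fun o => ih _ _ (hB₀.negDeformAt o) hCs) (fun o => ih _ _ (hB₀.posDeformAt o) hCs)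
      have bj : ∀ j : Fin Cs.length, |SD (Cs.get j) (fun C' => u B₀ (Cs.set j C'))| ≤
          c * (((∑ o : InvIdx (Cs.get j), K ^ (B₀ ++ (Cs.set j ((Cs.get j).negSplitAt o)).flatten).index
                  * catProd (B₀ ++ (Cs.set j ((Cs.get j).negSplitAt o)).flatten))
              + ∑ o : SameIdx (Cs.get j), K ^ (B₀ ++ (Cs.set j ((Cs.get j).posSplitAt o)).flatten).index
                  * catProd (B₀ ++ (Cs.set j ((Cs.get j).posSplitAt o)).flatten))
            + |β| * ((∑ o : DeformIdx (Cs.get j), K ^ (B₀ ++ (Cs.set j ((Cs.get j).negDeformAt o)).flatten).index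
                  * catProd (B₀ ++ (Cs.set j ((Cs.get j).negDeformAt o)).flatten))
              + ∑ o : DeformIdx (Cs.get j), K ^ (B₀ ++ (Cs.set j ((Cs.get j).posDeformAt o)).flatten).index
                  * catProd (B₀ ++ (Cs.set j ((Cs.get j).posDeformAt o)).flatten))) := by
        intro j
        have hCj : IsLoopSeq (Cs.get j) := hCs _ (List.get_mem Cs j)
        exact SD_abs_le SD hSD (Cs.get j) (fun C' => u B₀ (Cs.set j C'))
          (fun C' => K ^ (B₀ ++ (Cs.set j C').flatten).index * catProd (B₀ ++ (Cs.set j C').flatten)) c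
          (fun o => ih _ _ hB₀ (forall_mem_set hCs (hCj.negSplitAt o) j))
          (fun o => ih _ _ hB₀ (forall_mem_set hCs (hCj.posSplitAt o) j))
          (fun o => ih _ _ hB₀ (forall_mem_set hCs (hCj.negDeformAt o) j))
          (fun o => ih _ _ hB₀ (forall_mem_set hCs (hCj.posDeformAt o) j))
      have hW := block_weight_le hK1 β hB₀ hCs hflat
      rw [← hPdef] at hW
      -- assemble
      have htot : (s.len : ℝ) * |u B₀ Cs| ≤ c * ((s.len : ℝ) * (θ * (K ^ s.index * catProd s))) := by
        have e' : (s.len : ℝ) * u B₀ Cs = SD B₀ (fun A => u A Cs) + ∑ j : Fin Cs.length, SD (Cs.get j) (fun C' => u B₀ (Cs.set j C')) := by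
          rw [hs]; linarith [e]
        calc (s.len : ℝ) * |u B₀ Cs| = |(s.len : ℝ) * u B₀ Cs| := by rw [abs_mul, abs_of_pos hlen]
          _ ≤ |SD B₀ (fun A => u A Cs)| + ∑ j : Fin Cs.length, |SD (Cs.get j) (fun C' => u B₀ (Cs.set j C'))| := by
              rw [e']; exact (abs_add_le _ _).trans (add_le_add le_rfl (Finset.abs_sum_le_sum_abs _ _))
          _ ≤ _ := by
              refine (add_le_add b0 (Finset.sum_le_sum fun j _ => bj j)).trans ?_
              rw [← Finset.mul_sum, ← mul_add]
              exact mul_le_mul_of_nonneg_left hW hc0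
      have hfin : (s.len : ℝ) * |u B₀ Cs| ≤ (s.len : ℝ) * (c * θ * (K ^ s.index * catProd s)) := by
        calc (s.len : ℝ) * |u B₀ Cs| ≤ c * ((s.len : ℝ) * (θ * (K ^ s.index * catProd s))) := htot
          _ = (s.len : ℝ) * (c * θ * (K ^ s.index * catProd s)) := by ring
      have := le_of_mul_le_mul_left hfin hlen
      calc |u B₀ Cs| ≤ c * θ * (K ^ s.index * catProd s) := this
        _ = Mb * θ ^ (n + 1) * (K ^ s.index * catProd s) := by rw [hc, pow_succ]; ring
  intro B₀ Cs hB₀ hCs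
  have hlim : Tendsto (fun n : ℕ => Mb * θ ^ n * (K ^ (B₀ ++ Cs.flatten).index * catProd (B₀ ++ Cs.flatten))) atTop (𝓝 0) := by
    have h := ((tendsto_pow_atTop_nhds_zero_of_lt_one hθ0 hθ1).const_mul Mb).mul_const
      (K ^ (B₀ ++ Cs.flatten).index * catProd (B₀ ++ Cs.flatten))
    simpa only [mul_zero, zero_mul] using h
  have habs : |u B₀ Cs| ≤ 0 := ge_of_tendsto' hlim fun n => hiter n B₀ Cs hB₀ hCs
  exact abs_nonpos_iff.mp habs

/-! ## Small bookkeeping -/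

/-- `|C₁ ++ ⋯ ++ C_m| = Σ |C_j|`. [folklore] -/
theorem len_flatten : ∀ Cs : List (LoopSeq d), LoopSeq.len Cs.flatten = (Cs.map LoopSeq.len).sum
  | [] => rfl
  | C :: rest => by rw [List.flatten_cons, LoopSeq.len_append, len_flatten rest, List.map_cons, List.sum_cons]

/-- Non-empty null-free blocks have positive length, so `m ≤ Σ |C_j|`. [folklore] -/
theorem length_le_sum_len : ∀ Cs : List (LoopSeq d), (∀ C ∈ Cs, IsLoopSeq C ∧ C ≠ []) → Cs.length ≤ (Cs.map LoopSeq.len).sum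
  | [], _ => le_rfl
  | C :: rest, h => by
    have hC := h C (by simp)
    have h1 : 1 ≤ C.len := len_pos_of_components_ne_nil hC.2 fun l hl => (hC.1 l hl).2
    have h2 := length_le_sum_len rest fun C' hC' => h C' (List.mem_cons_of_mem C hC')
    rw [List.length_cons, List.map_cons, List.sum_cons]
    omega

end StringDuality

end Summit.QuantumFields.GaugeBoot

end
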